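import Summits.ResolutionOfSingularities.ResolutionOfSingularities.Theorems.WeightedInvariantKeyRungThreeOfResidue
import Summits.ResolutionOfSingularities.ResolutionOfSingularities.Theorems.WeightedInvariantIota3SigmaLevelBoundOfDominance
import Summits.ResolutionOfSingularities.ResolutionOfSingularities.Theorems.WeightedInvariantIota3SigmaMaximiserOfLevelBound
import Summits.ResolutionOfSingularities.ResolutionOfSingularities.Theorems.WeightedInvariantIota3SigmaPresentationOfDominance
import HarnessLib

/-!
# (EX), (J-can) and the σ-presentation of `J₃ᵗ` OUTRIGHT at every LE3 point-centre position whose tangent form is not `c·ℓ^ν`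
# (door `HypersurfaceCentreConstruction`, stmt-ResolutionOfSingularities-19897; P3 rung for the named pair `(ι₃ᵗ, J₃ᵗ)`: h8's point bodies
# (P₀₀)/(P₀₁) ⟸ (σ-pres)₃; (o70-a) (EX)≤3; (o70-b) (J-can)≤3)

Topic: `Summits/ResolutionOfSingularities/ResolutionOfSingularities/Theorems`. Helper for the door item `HypersurfaceCentreConstruction`
(stmt-ResolutionOfSingularities-19897, route `WeightedInvariant`), line `local-engine`, def-free.  The words (EX)≤3, (J-can)≤3 and (σ-pres)₃ of
SPEC (Δ12) are routed through the ONE dominance word `TwoFlagDominanceAtLevelLE3Body p` (…Iota3SigmaPresentationOfDominance), whose residue this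
hand confined to the positions with `in_𝔪(f) = c·ℓ^ν` (`Iota3.twoFlagDominanceAtLevelAt_of_not_power`, …KeyRungThreeOfResidue).  Running the
landed POINTWISE chain at one position — level bound (`RatContact.levelBound_{isolated,tie}_of_dominanceAtLevel`, res-D-pv-036/038), (EX)
(`RatContact.exists_isSigmaMaximiser_of_levelBound`), (J-can) (`jSigmaCanonicalAt_of_oneSided`, res-D-brk-1 PART 2b), the presentation
(`jFlatT_eq_weightedMonomialIdeal_of_canonicalAt`) — gives `Iota3.sigmaPresentationAt_of_not_power`: at every LE3 point-centre position (`S`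
regular local essentially of finite type over a field, `dim S = 3`, `0 ≠ f ∈ 𝔪²`, top `(ν;ε;τ)`-stratum `= {𝔪}`, `ε ≠ 1`) with
`f ∉ (ℓ^ν) + 𝔪^{ν+1}` for all `ℓ ∈ 𝔪`, a σ-maximiser with a primitive triple EXISTS, (J-can) HOLDS, and `jFlatT S f` IS a positively weighted
monomial filtration of a minimal generating triple — unconditionally.  So (EX)≤3, (J-can)≤3, (σ-pres)₃ are open only at the positions whose
tangent form is a `ν`-th power of a linear form.
[OURS · L1 W4.3 · (o70-a)/(o70-b)/(σ-pres)₃; candidates stay candidates; nothing here is a statement of H. Hironaka's 2017 manuscript; AI-written,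
weaker than expert review; no claim about resolution of singularities in characteristic `p` beyond the typed statements.]  No definition; no axiom.

## References

* H. Matsumura, *Commutative Ring Theory* (1987), §32 (excellence of algebras essentially of finite type over a field). [Matsumura1987]
-/

noncomputable section

set_option linter.dupNamespace false -- mandated namespace of this single-conjunct summit

open IsLocalRing Literature.AlgebraicGeometry.Resolution
open Summit.ResolutionOfSingularities.ResolutionOfSingularities.Theorems
open Summit.ResolutionOfSingularities.ResolutionOfSingularities.Theorems.ContactCylinder

namespace Summit.ResolutionOfSingularities.ResolutionOfSingularities.Cruxes.HypersurfaceCentreConstruction.LocalEngine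

namespace Iota3

/-- **(EX), (J-can) AND THE σ-PRESENTATION OF `J₃ᵗ` HOLD OUTRIGHT AT EVERY LE3 POINT-CENTRE POSITION WHOSE TANGENT FORM IS NOT A `ν`-TH
POWER OF A LINEAR FORM.**  `S` regular local, essentially of finite type over a field, `dim S = 3`, `0 ≠ f ∈ 𝔪²`, top `(ν;ε;τ)`-stratum the
closed point, `ε ≠ 1`, and `f ∉ (ℓ^ν) + 𝔪^{ν+1}` for every `ℓ ∈ 𝔪` (`ν = ord f`).  Then: a σ-maximiser with a primitive triple exists, (J-can)
holds at `f`, and `jFlatT S f` is a positively weighted monomial filtration of a minimal generating triple.  Chain: the dominance word at `f`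
OUTRIGHT (`twoFlagDominanceAtLevelAt_of_not_power`) ⇒ the level bound (`RatContact.levelBound_{isolated,tie}_of_dominanceAtLevel`) ⇒ (EX)
(`RatContact.exists_isSigmaMaximiser_of_levelBound`) ⇒ (J-can) (`jSigmaCanonicalAt_of_oneSided` ∘ `sigmaOneSidedDominanceAt_of_atLevel`) ⇒ the
presentation (`jFlatT_eq_weightedMonomialIdeal_of_canonicalAt`).  So (σ-pres)₃ — hence the point bodies (P₀₀)/(P₀₁) of h8 — is OPEN only at the
positions `in_𝔪(f) = c·ℓ^ν`. [OURS · L1 W4.3 · (o70-a)/(o70-b)/(σ-pres)₃] [cite: Matsumura1987, §32] -/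
theorem sigmaPresentationAt_of_not_power (k₀ : Type) [Field k₀]
    (S : Type) [CommRing S] [Algebra k₀ S] [Algebra.EssFiniteType k₀ S] [IsRegularLocalRing S] (f : S)
    (hdim : ringKrullDim S = (3 : ℕ)) (hf0 : f ≠ 0) (hf2 : f ∈ maximalIdeal S ^ 2)
    (htop : ContactCylinder.topStratumPrime iotaOrdEpsTau S f = maximalIdeal S) (hε : iotaEps S f ≠ 1)
    (hNP : ∀ ℓ ∈ maximalIdeal S, f ∉ Ideal.span {ℓ ^ (adicOrder f).toNat} ⊔ maximalIdeal S ^ ((adicOrder f).toNat + 1)) :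
    (∃ (g₁ g₂ : S) (q r₁ r₂ : ℕ), IsSigmaMaximiser f (adicOrder f).toNat g₁ g₂ q r₁ r₂ ∧ IsPrimitiveTriple q r₁ r₂) ∧
    JSigmaCanonicalAt f ∧
    ∃ (n : ℕ) (u : Fin n → S) (w : Fin n → ℕ), Ideal.span (Set.range u) = maximalIdeal S ∧ (maximalIdeal S).spanFinrank = n ∧
      (∀ i, 0 < w i) ∧ ∀ m : ℕ, weightedMonomialIdeal u w m = jFlatT S f m := by
  have hk : IsExcellentRing k₀ := Stacks07QW_field_holds k₀ k₀ inferInstance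
  have hS : IsExcellentRing S := hk.of_essFiniteType ‹_›
  have hf : f ∈ maximalIdeal S := Ideal.pow_le_self two_ne_zero hf2
  have hnm : ¬ IsMonomialType f := not_isMonomialType_of_topStratumPrime_eq_maximalIdeal hdim hf htop
  have hdim3 : ringKrullDim S = 3 := by rw [hdim]; norm_cast
  have hdom : TwoFlagDominanceAtLevelAt f := twoFlagDominanceAtLevelAt_of_not_power hdim hf0 hf hNP
  have hEX : ∃ (g₁ g₂ : S) (q r₁ r₂ : ℕ), IsSigmaMaximiser f (adicOrder f).toNat g₁ g₂ q r₁ r₂ ∧ IsPrimitiveTriple q r₁ r₂ := by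
    rcases iotaTau_eq_zero_or_eq_one S f with hτ | hτ
    · have hε0 : iotaEps S f = 0 := (iotaEps_eq_zero_or_eq_one S f).resolve_right hε
      obtain ⟨L, hL⟩ := RatContact.levelBound_isolated_of_dominanceAtLevel hS hdim3 hf0 hf2 hnm
        (fun 𝔭 _ hf𝔭 => IsolatedPoint.strat_iotaOrd_maximalIdeal hf htop hε0 hτ 𝔭 hf𝔭) hdom
      exact RatContact.exists_isSigmaMaximiser_of_levelBound hS hdim3 hf0 hf2 hnm L hL
    · have htie : IsTiePosition S f := (iotaTau_eq_one_iff_isTiePosition hdim3.le f).mp hτ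
      obtain ⟨L, hL⟩ := RatContact.levelBound_tie_of_dominanceAtLevel hS hdim3 hf0 hf2 hnm htie hdom
      exact RatContact.exists_isSigmaMaximiser_of_levelBound hS hdim3 hf0 hf2 hnm L hL
  have hcan : JSigmaCanonicalAt f := jSigmaCanonicalAt_of_oneSided hf0 hf (sigmaOneSidedDominanceAt_of_atLevel hdom)
  refine ⟨hEX, hcan, ?_⟩
  obtain ⟨g₁, g₂, q, r₁, r₂, hmax, hprim⟩ := hEX
  obtain ⟨x, h𝔪, h3⟩ := exists_span_triple_of_isTwoFlag S hdim g₁ g₂ hmax.2.1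
  have hfu : ¬ IsUnit f := (IsLocalRing.mem_maximalIdeal _).mp hf
  have hd : ¬ ringKrullDim S ≤ 2 := by
    rw [hdim]
    decide
  refine ⟨3, ![x, g₂, g₁], ![q, r₂, r₁], by rw [range_vec₃, h𝔪], h3, ?_, fun m =>
    (jFlatT_eq_weightedMonomialIdeal_of_canonicalAt hf0 hfu htop hd hε hcan hmax hprim h𝔪 m).symm⟩
  intro i
  fin_cases i
  · exact hmax.1.pos.1
  · exact hmax.1.pos.2.1
  · exact hmax.1.pos.2.2

end Iota3

end Summit.ResolutionOfSingularities.ResolutionOfSingularities.Cruxes.HypersurfaceCentreConstruction.LocalEngine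

end
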